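import Summits.QuantumFields.BalabanUV.T4Continuum.Support.NE7AxialGaugeGradient
import Summits.QuantumFields.BalabanUV.T4Continuum.Support.NE7GradientCurrency
import Summits.QuantumFields.BalabanUV.T4Continuum.Support.AveragingDeficitPlaqDeriv
import Summits.QuantumFields.BalabanUV.T4Continuum.Support.NE3FramePotBound
import HarnessLib

/-!
# NE7PlaqGradDictionary — THE PLAQUETTE-GRADIENT DICTIONARY: the covariant plaquette gradient of `W = e^{A}` in every direction is bounded by the SECOND
# differences of `A`, plus `(e^{4ρ} − 1)`·(first differences) and `(e^{ρ} − 1)`·(plaquette radius):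
# `‖Ad_{W(q,τ)}W(∂p_{κμ}(q+e_τ)) − W(∂p_{κμ}(q))‖ ≤ 2a₂ + 4(e^{4ρ} − 1)a₁ + 2(e^{ρ} − 1)x` — so (PG) ⇐ [Balaban1985Variational] Thm 1 (9) with `β = 1`, read literally

Cell `pub-balaban`, rung (B)+1 sub-cell t4, lineage `b2b-balaban-t4-ne7-p1` (CRUX PROVER NE7 #1 = OWNER of row NE7), generation 91; memo
`t4/b2b-balaban-t4-ne7-p1-g91/COVER-OBSTRUCTION.md` §5.  Over `NE7GradientCurrency` (the BCH plaquette remainder is Lipschitz in the four exponents: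
`norm_plaqRem_sub_plaqRem_le`; `hol_vary_flat_plaqWord`), `NE3LadderCovariantDifference.norm_Ad_sub_le_of_sub_one`, F289 `NE7AxialGaugeGradient.norm_plaqGradDir_gaugeAct`
(gauge invariance of the datum).

WHY.  After F291∕F292 (`hint_of_plaqGrad_SU2` ∕ `hint_of_plaqGrad`) the ONE NE7-specific analytic input of route 1's END is (PG): the covariant plaquette-gradient
radius `≤ C_g·t∕M³` of the tangent-critical admissible configuration, in every lattice direction.  [Balaban1985Variational] Thm 1 (9)–(10) prints, for the
minimiser on a cube in a suitable gauge `U^{u} = e^{A}`: `|A| < B₃M_cε₁(L^jη)^{−1}`, `|∇A| < B₃M_cε₁(L^jη)^{−2}`, `‖A‖_{1,β} < B₄(β₀)M_cε₁(L^jη)^{−2−β}` for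
`0 ≤ β ≤ β₀ = 1` — at `β = 1` the last is a bound on the SECOND lattice differences of `A` at the scale `M^{−3}`.  THIS FILE is the kinematic dictionary turning
those three letters (`ρ`, `a₁`, `a₂`) and the plaquette radius `x` into (PG): `2a₂ + 4(e^{4ρ}−1)a₁ + 2(e^{ρ}−1)x ≍ t∕M³·(2 + O(ℓt))` at `ρ ≍ ℓt∕M`, `a₁ ≍ t∕M²`,
`a₂ ≍ t∕M³`, `x ≍ t∕M²`.  The datum is gauge invariant (F289 `norm_plaqGradDir_gaugeAct`), so the gauge of (9) may be used cube by cube.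
WHAT ([folklore]; 0 def, 0 sorry; every dimension).  §1 `flatCurl_shift_eq` (the `τ`-shift of the flat curl is a combination of two second differences).
§2 **`norm_plaqGradDir_exp_le`** — the displayed bound for `W = vary flat A 1` (`A` skew); **`norm_plaqGradDir_le_of_gauge_exp`** — the same for any unitary `U` and
unitary gauge `u` with `U^{u} = e^{A}`.
HONEST FRAMING (page 1): kinematics of `e^{A}`; (PG) is NOT proved here (it needs the letters `ρ, a₁, a₂` of the minimiser — [B11] Thm 1 (9) TYPE, asserted nowhere);
NE7 NOT PROVED; nothing of Bałaban's asserted; spine 0∕9; finite T⁴ rung (B)+1 — NOT infinite volume, NOT mass gap, NOT `BetaPertH`, NOT Clay.  Continuum YM on T⁴ ⇐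
BetaPertH ∧ nine spine estimates (0/9 proved); BetaPertH ⇐ (D1) ∧ (D4) ∧ CAP+tail; G-an2-4 gates asym, D1 and NE2/3/4.  No `sorry`; axioms ⊆ {propext,
Classical.choice, Quot.sound}.  PLACEMENT: our lemma, under `Summits/QuantumFields/BalabanUV/`.
-/

set_option autoImplicit false

open scoped BigOperators Matrix Matrix.Norms.L2Operator
open NormedSpace Finset

namespace Summit.QuantumFields.BalabanUV.T4Continuum.NE7PlaqGradDictionary

open Literature.MathematicalPhysics.QuantumFieldTheory.Balaban1983to89
open B7Prop1Explicit B7Prop2Explicit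
open T4AveragingDeficitWall (Ad IsUnitaryCfg IsSkewDir SmallField vary)
open AveragingDeficitTransport (norm_Ad_of_unitary mem_U1_of_unitary)
open AveragingDeficitPlaqDeriv (vary_isUnitaryCfg)
open NE3FramePotBound (isUnitaryCfg_flat)
open NE3LadderCovariantDifference (norm_coe_eq_one norm_Ad_sub_le_of_sub_one)
open BlockAveragePushDirSplit (flat)
open NE7GradientCurrency (norm_plaqRem_sub_plaqRem_le hol_vary_flat_plaqWord vary_flat_one_apply norm_exp_sub_one_le)
open NE7AxialGaugeGradient (norm_plaqGradDir_gaugeAct)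

noncomputable section

variable {d : ℕ} {n : Type*} [Fintype n] [DecidableEq n]

/-! ## §1 The shift of the flat curl is two second differences -/

/-- **THE `τ`-SHIFT OF THE FLAT CURL** `A(q)_κ + A(q+e_κ)_μ − A(q+e_μ)_κ − A(q)_μ` is `−∂_μ∂_τA_κ(q) + ∂_κ∂_τA_μ(q)`. [folklore] -/
theorem flatCurl_shift_eq {E : Type*} [AddCommGroup E] (A : Site d → Fin d → E) (q : Site d) (τ κ μ : Fin d) :
    (A (q + e τ) κ + A (q + e τ + e κ) μ + -A (q + e τ + e μ) κ + -A (q + e τ) μ) - (A q κ + A (q + e κ) μ + -A (q + e μ) κ + -A q μ)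
      = -((A (q + e μ + e τ) κ - A (q + e μ) κ) - (A (q + e τ) κ - A q κ))
        + ((A (q + e κ + e τ) μ - A (q + e κ) μ) - (A (q + e τ) μ - A q μ)) := by
  rw [show q + e τ + e κ = q + e κ + e τ by abel, show q + e τ + e μ = q + e μ + e τ by abel]
  abel

/-! ## §2 The dictionary -/

/-- **THE PLAQUETTE-GRADIENT DICTIONARY FOR `W = e^{A}`.**  For a skew `A : ℤᵈ → (Fin d → M_n(ℂ))` with `‖A‖ ≤ ρ`, first differences `≤ a₁` (all directions), second
differences `≤ a₂` (all pairs of directions) and plaquette radius `x` of `W = vary flat A 1`: for every bond direction `τ` and plaquette directions `κ ≠ μ`,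
`‖Ad_{W(q,τ)}W(∂p_{κμ}(q+e_τ)) − W(∂p_{κμ}(q))‖ ≤ 2a₂ + 4(e^{4ρ} − 1)a₁ + 2(e^{ρ} − 1)x`: the difference of the two plaquette variables is the shift of the flat curl
(two second differences) plus the shift of the BCH remainder (Lipschitz in the four exponents, `norm_plaqRem_sub_plaqRem_le`), and the transport `Ad_{W(q,τ)} − 1` costs
`2‖W(q,τ) − 1‖·‖W(∂p) − 1‖`. [folklore] -/
theorem norm_plaqGradDir_exp_le [Nonempty n] (A : Site d → Fin d → Matrix n n ℂ) (hAs : IsSkewDir A) {ρ a₁ a₂ x : ℝ}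
    (hA : ∀ (y : Site d) (κ : Fin d), ‖A y κ‖ ≤ ρ)
    (hA1 : ∀ (y : Site d) (κ τ : Fin d), ‖A (y + e τ) κ - A y κ‖ ≤ a₁)
    (hA2 : ∀ (y : Site d) (κ τ σ : Fin d), ‖(A (y + e σ + e τ) κ - A (y + e σ) κ) - (A (y + e τ) κ - A y κ)‖ ≤ a₂)
    (hWx : SmallField (vary (flat (d := d) (n := n)) A 1) x) (q : Site d) (τ κ μ : Fin d) (hκμ : κ ≠ μ) :
    ‖Ad (vary (flat (d := d) (n := n)) A 1 q τ) ((hol (vary (flat (d := d) (n := n)) A 1) (q + e τ) (plaqWord κ μ) : (Matrix n n ℂ)ˣ) : Matrix n n ℂ)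
        - ((hol (vary (flat (d := d) (n := n)) A 1) q (plaqWord κ μ) : (Matrix n n ℂ)ˣ) : Matrix n n ℂ)‖
      ≤ 2 * a₂ + 4 * (Real.exp (4 * ρ) - 1) * a₁ + 2 * (Real.exp ρ - 1) * x := by
  set W : Site d → Fin d → (Matrix n n ℂ)ˣ := vary (flat (d := d) (n := n)) A 1 with hW
  have hWu : IsUnitaryCfg W := vary_isUnitaryCfg isUnitaryCfg_flat hAs 1
  set P' : Matrix n n ℂ := ((hol W (q + e τ) (plaqWord κ μ) : (Matrix n n ℂ)ˣ) : Matrix n n ℂ) with hP'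
  set P : Matrix n n ℂ := ((hol W q (plaqWord κ μ) : (Matrix n n ℂ)ˣ) : Matrix n n ℂ) with hP
  -- the transport term
  have hx' : ‖P' - 1‖ ≤ x := hWx (q + e τ) κ μ hκμ
  have hu : ‖((W q τ : (Matrix n n ℂ)ˣ) : Matrix n n ℂ) - 1‖ ≤ Real.exp ρ - 1 := by
    rw [hW, vary_flat_one_apply, val_expUnit]
    exact norm_exp_sub_one_le (hA q τ)
  have t1 : ‖Ad (W q τ) P' - P'‖ ≤ 2 * (Real.exp ρ - 1) * x := by
    refine (norm_Ad_sub_le_of_sub_one (hWu q τ) P').trans ?_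
    have h0 : 0 ≤ ‖((W q τ : (Matrix n n ℂ)ˣ) : Matrix n n ℂ) - 1‖ := norm_nonneg _
    have h1 : 0 ≤ ‖P' - 1‖ := norm_nonneg _
    nlinarith [mul_le_mul hu hx' h1 ((norm_nonneg _).trans hu)]
  -- the four exponents at `q` and at `q + e_τ`
  have hPeq : P = exp (A q κ) * exp (A (q + e κ) μ) * exp (-A (q + e μ) κ) * exp (-A q μ) := by rw [hP, hW, hol_vary_flat_plaqWord]
  have hP'eq : P' = exp (A (q + e τ) κ) * exp (A (q + e τ + e κ) μ) * exp (-A (q + e τ + e μ) κ) * exp (-A (q + e τ) μ) := by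
    rw [hP', hW, hol_vary_flat_plaqWord]
  have hn : ∀ (y : Site d) (ν : Fin d), ‖-A y ν‖ ≤ ρ := fun y ν => by rw [norm_neg]; exact hA y ν
  have hrem := norm_plaqRem_sub_plaqRem_le (hA (q + e τ) κ) (hA (q + e τ + e κ) μ) (hn (q + e τ + e μ) κ) (hn (q + e τ) μ)
    (hA q κ) (hA (q + e κ) μ) (hn (q + e μ) κ) (hn q μ)
  -- the four first differences
  have d1 : ‖A (q + e τ) κ - A q κ‖ ≤ a₁ := hA1 q κ τ
  have d2 : ‖A (q + e τ + e κ) μ - A (q + e κ) μ‖ ≤ a₁ := by rw [show q + e τ + e κ = q + e κ + e τ by abel]; exact hA1 _ μ τ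
  have d3 : ‖-A (q + e τ + e μ) κ - -A (q + e μ) κ‖ ≤ a₁ := by
    rw [show -A (q + e τ + e μ) κ - -A (q + e μ) κ = -(A (q + e μ + e τ) κ - A (q + e μ) κ) by
      rw [show q + e τ + e μ = q + e μ + e τ by abel]; abel, norm_neg]
    exact hA1 _ κ τ
  have d4 : ‖-A (q + e τ) μ - -A q μ‖ ≤ a₁ := by
    rw [show -A (q + e τ) μ - -A q μ = -(A (q + e τ) μ - A q μ) by abel, norm_neg]; exact hA1 q μ τ
  -- the flat-curl shift: two second differences
  have hS : ‖(A (q + e τ) κ + A (q + e τ + e κ) μ + -A (q + e τ + e μ) κ + -A (q + e τ) μ) - (A q κ + A (q + e κ) μ + -A (q + e μ) κ + -A q μ)‖ ≤ 2 * a₂ := by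
    rw [flatCurl_shift_eq]
    refine (norm_add_le _ _).trans ?_
    rw [norm_neg]
    have h1 := hA2 q κ τ μ
    have h2 := hA2 q μ τ κ
    linarith
  -- assemble: `Ad P' − P = (Ad P' − P') + (S' − S) + (Rem' − Rem)`
  have he0 : 0 ≤ Real.exp (4 * ρ) - 1 := by
    have hρ : 0 ≤ ρ := (norm_nonneg _).trans (hA q κ)
    nlinarith [Real.add_one_le_exp (4 * ρ)]
  have hsplit : Ad (W q τ) P' - P = (Ad (W q τ) P' - P')
      + ((A (q + e τ) κ + A (q + e τ + e κ) μ + -A (q + e τ + e μ) κ + -A (q + e τ) μ) - (A q κ + A (q + e κ) μ + -A (q + e μ) κ + -A q μ))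
      + ((exp (A (q + e τ) κ) * exp (A (q + e τ + e κ) μ) * exp (-A (q + e τ + e μ) κ) * exp (-A (q + e τ) μ) - 1
            - (A (q + e τ) κ + A (q + e τ + e κ) μ + -A (q + e τ + e μ) κ + -A (q + e τ) μ))
          - (exp (A q κ) * exp (A (q + e κ) μ) * exp (-A (q + e μ) κ) * exp (-A q μ) - 1 - (A q κ + A (q + e κ) μ + -A (q + e μ) κ + -A q μ))) := by
    rw [← hPeq, ← hP'eq]; abel
  rw [hsplit]
  refine (norm_add₃_le).trans ?_
  have hrem' := hrem.trans (mul_le_mul_of_nonneg_left (show ‖A (q + e τ) κ - A q κ‖ + ‖A (q + e τ + e κ) μ - A (q + e κ) μ‖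
      + ‖-A (q + e τ + e μ) κ - -A (q + e μ) κ‖ + ‖-A (q + e τ) μ - -A q μ‖ ≤ 4 * a₁ by linarith) he0)
  linarith

/-- **THE DICTIONARY IN GAUGE-INVARIANT FORM.**  For a unitary `U`, a unitary gauge `u` and a skew `A` with `U^{u} = vary flat A 1`, letters `ρ, a₁, a₂` of `A` as
above and plaquette radius `x` of `U`: the covariant plaquette gradient of `U` itself obeys `≤ 2a₂ + 4(e^{4ρ} − 1)a₁ + 2(e^{ρ} − 1)x` (gauge invariance,
F289 `norm_plaqGradDir_gaugeAct`). [folklore] -/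
theorem norm_plaqGradDir_le_of_gauge_exp [Nonempty n] {U : Site d → Fin d → (Matrix n n ℂ)ˣ} {u : Site d → (Matrix n n ℂ)ˣ}
    (hu : ∀ z, u z ∈ unitaryUnits (Matrix n n ℂ)) (A : Site d → Fin d → Matrix n n ℂ) (hAs : IsSkewDir A)
    (hUA : gaugeAct u U = vary (flat (d := d) (n := n)) A 1) {ρ a₁ a₂ x : ℝ}
    (hA : ∀ (y : Site d) (κ : Fin d), ‖A y κ‖ ≤ ρ)
    (hA1 : ∀ (y : Site d) (κ τ : Fin d), ‖A (y + e τ) κ - A y κ‖ ≤ a₁)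
    (hA2 : ∀ (y : Site d) (κ τ σ : Fin d), ‖(A (y + e σ + e τ) κ - A (y + e σ) κ) - (A (y + e τ) κ - A y κ)‖ ≤ a₂)
    (hUx : SmallField U x) (q : Site d) (τ κ μ : Fin d) (hκμ : κ ≠ μ) :
    ‖Ad (U q τ) ((hol U (q + e τ) (plaqWord κ μ) : (Matrix n n ℂ)ˣ) : Matrix n n ℂ) - ((hol U q (plaqWord κ μ) : (Matrix n n ℂ)ˣ) : Matrix n n ℂ)‖
      ≤ 2 * a₂ + 4 * (Real.exp (4 * ρ) - 1) * a₁ + 2 * (Real.exp ρ - 1) * x := by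
  have hWx : SmallField (vary (flat (d := d) (n := n)) A 1) x := by
    rw [← hUA]; exact NE3AxialGaugeLadder.smallField_gaugeAct hu hUx
  rw [← norm_plaqGradDir_gaugeAct hu q τ μ κ, hUA]
  exact norm_plaqGradDir_exp_le A hAs hA hA1 hA2 hWx q τ κ μ hκμ

end

end Summit.QuantumFields.BalabanUV.T4Continuum.NE7PlaqGradDictionary
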